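import Summits.BirchSwinnertonDyer.BirchSwinnertonDyer.Theorems.PrintCf2SplitBadTwoF3LevelLiftInputs
import Summits.BirchSwinnertonDyer.BirchSwinnertonDyer.Theorems.PrintCf2SplitBadTwoRestrictedControlOfPTFactsF1F3H2
import HarnessLib

/-!
# Crux `PrintCf2.SplitBadTwoRankOneOfFacts` (stmt-BirchSwinnertonDyer-20368), road α v10.3, S3c residual (F3) REDUCED TO A LEVEL-`N` INDEX COUNT:
# `hF3` of cut 14 ⟸ `hcounts` (the 2-adic valuation of `[H¹_{𝓕[v ↦ ⊤]}(K, E[2^N]) : H¹_𝓕(K, E[2^N])]` for the OPTION A‴ structures)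

Cell `bsd-print-cf2`, EXTRA WIDTH seat `bsd-line-cf2-p1-w5` g3; `--supports stmt-BirchSwinnertonDyer-20368` (helper, Theses-free). HONEST FRAMING:
nothing here closes the crux or a registered stub; BSD is not proved by any of this; no summit statement is proved by this seat. No definition,
no named fact, no `sorry`, no kit. beyond-print theorem: no.
WHAT. **`hF3_of_levelCounts (hcounts) : <hypothesis hF3 of cut 14 `restrictedControl_two_of_ptFacts_F1_F3_H2` (p677854) VERBATIM>`**, where the
displayed hypothesis `hcounts` is `hF3` with its conclusion replaced by: for EVERY CM projector `e : E[2^∞] → W*` (identity on `W*`, zero on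
`W*′ = E[𝔮_{1−r}^∞]`, equivariant) there is `N₁` such that for every `N ≥ N₁` SOME level-`N` shadow `eN` (`ι_N ∘ eN = e ∘ ι_N`; e.g. p669287
`exists_levelProj` or p677924 `exists_isotropic_levelSplitting_of_frame`) makes, for EVERY torsion structure `𝓕` on `E[2^N]` with `⊤` at infinity,
the propagated zero condition off `v` and the e-relaxed condition `(N^E_v).comap H¹(eN|K_v)` at `v` (binder shapes of p677230 / p675947),
`v₂ [H¹_{𝓕[v ↦ ⊤]} : H¹_𝓕] = ℓ + e₃(d % 2, (d/(2 − d % 2)) % 8)`. Proof: (P1) p678012 `exists_relIndex_selmerGroup_eq_natCard_range_resOfLe` at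
`N = max N₀ N₁` (the frame's `e` from -w7 g2 `exists_eigenProjector_two`, `hall` from `CMPrimes.eq_or_eq_of_two_mem`). So cut 15 reads
`restrictedControl_two_of_ptFacts_F1_F3_H2 hPT hPTs hcd hF1 (hF3_of_levelCounts hcounts) hH2` : S3c ⟸ 3 cited facts ∧ (F1) ∧ hcounts ∧ (H2); the
remaining (F3) work (-w4 g9 master identity p677803/p677924/…, -w8 g3 «≥», -w2 g11 F3-GLOBAL) targets `hcounts`.
References: [GreenbergLNM1716] §5 proof of Prop. 5.8; [MazurRubin2004] Def. 2.1.1; [Agboola2007] §3, §6; [Rubin1999] §2.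
-/

noncomputable section

open scoped Classical

set_option linter.dupNamespace false
set_option autoImplicit false

open NumberField IsDedekindDomain Field WeierstrassCurve
open Literature.NumberTheory.EllipticCurves Literature.NumberTheory.EllipticCurves.GreenbergSelmer
open Literature.NumberTheory.EllipticCurves.Agboola2007
open Literature.NumberTheory.EllipticCurves.IwasawaAlgebra
open Literature.NumberTheory.EllipticCurves.IwasawaDual
open Literature.NumberTheory.EllipticCurves.ResKernel
open Literature.NumberTheory.GaloisRepresentations
open Literature.NumberTheory.GaloisRepresentations.DiscreteGaloisModule (SelmerStructure)
open Literature.NumberTheory.GaloisCohomology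
open Literature.NumberTheory.EllipticCurves.Castella2018.AcSelmer
open scoped ContRepresentation
open Summit.BirchSwinnertonDyer.Rank1Residual.X11b
open Summit.BirchSwinnertonDyer.Rank1Residual.X11b.Levels
open Summit.BirchSwinnertonDyer.BirchSwinnertonDyer.Theorems.PrintCf2.AdditiveAtSeven
open Summit.BirchSwinnertonDyer.BirchSwinnertonDyer.Theorems.GoldfeldGoodTwists

namespace Summit.BirchSwinnertonDyer.BirchSwinnertonDyer.Theorems.PrintCf2.RestrictedSelmerPair

/-- **(F3) ⟸ the level-`N` index count.** Hypothesis `hF3` of cut 14 (`restrictedControl_two_of_ptFacts_F1_F3_H2`, p677854) VERBATIM from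
`hcounts`: the same frame binders, and — for every CM projector `e` and all large `N`, some level shadow `eN`, every OPTION A‴ structure `𝓕` —
`v₂ [H¹_{𝓕[v ↦ ⊤]}(K, E[2^N]) : H¹_𝓕(K, E[2^N])] = ℓ + e₃`. ((P1): `#range(res_{D_v}|𝔖_v̄(K, W*)) = ` that index, p677230/p678012.)
[cite: GreenbergLNM1716, §5 proof of Prop. 5.8] [cite: Agboola2007, §6] [cite: Rubin1999, §2] -/
theorem hF3_of_levelCounts
    (hcounts : ∃ e₃ : ℤ → ℤ → ℤ, ∀ (d : ℤ), d ≠ 0 → Squarefree d → d % 4 ≠ 1 →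
      ∀ (W : WeierstrassCurve ℚ) [W.IsElliptic] [W.IsGloballyMinimal] (C : WeierstrassCurve.VariableChange ℚ),
        C • W = cm7.quadraticTwist (d : ℚ) → W.analyticRank = 1 →
      ∀ (K : Type) [Field K] [NumberField K], IsImaginaryQuadratic K →
      ∀ (v vbar : HeightOneSpectrum (𝓞 K)),
        ((2 : ℕ) : 𝓞 K) ∈ v.asIdeal → ((2 : ℕ) : 𝓞 K) ∈ vbar.asIdeal → vbar ≠ v →
      ∀ (π : (W.baseChange K).endRing), (π : AddMonoid.End (W.baseChange K).geomPoints) * π = π - 2 →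
      ∀ (r : ℤ_[2]), r * r = r - 2 →
        (∀ τ ∈ GreenbergSelmer.inertia v, ∀ x : ↥((W.baseChange K).endEigenPrimaryTorsion 2 π r), τ • x = x ∨ τ • x = -x) →
      ∀ (P : W.toAffine.Point) (c₀ : ℕ) (ℓ : ℤ),
        ¬ IsOfFinAddOrder P →
        (∀ R : W.toAffine.Point, ∃ (k : ℤ) (T : W.toAffine.Point), IsOfFinAddOrder T ∧ R = k • P + T) →
        c₀ ≠ 0 → (W.baseChange ℚ_[2]).IsInReductionKernel (c₀ • W.toPadicPoint 2 P) →
        ‖(W.baseChange ℚ_[2]).padicLogPoint (c₀ • W.toPadicPoint 2 P) / (c₀ : ℚ_[2])‖ = (2 : ℝ) ^ (-ℓ) →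
      Finite (restrictedSelmerBase ↥((W.baseChange K).endEigenPrimaryTorsion 2 π r) 2 vbar) →
      ∀ (e : (W.baseChange K).geomPrimaryTorsion 2 →+ ↥((W.baseChange K).endEigenPrimaryTorsion 2 π r)),
        (∀ x : ↥((W.baseChange K).endEigenPrimaryTorsion 2 π r), e x = x) →
        (∀ x ∈ (W.baseChange K).endEigenPrimaryTorsion 2 π (1 - r), e x = 0) →
        (∀ (σ : absoluteGaloisGroup K) (x : (W.baseChange K).geomPrimaryTorsion 2), e (σ • x) = σ • e x) →
      ∃ N₁ : ℕ, ∀ N : ℕ, N₁ ≤ N →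
        ∃ eN : ((W.baseChange K).torsionGaloisModule ((2 ^ N : ℕ) : ℤ)).toContRepresentation →ⁱL
            ((W.baseChange K).torsionGaloisModule ((2 ^ N : ℕ) : ℤ)).toContRepresentation,
          (∀ y, primaryInclusion (W.baseChange K) 2 N (eN y) =
            (e (primaryInclusion (W.baseChange K) 2 N y) : (W.baseChange K).geomPrimaryTorsion 2)) ∧
          ∀ 𝓕 : SelmerStructure ((W.baseChange K).torsionGaloisModule ((2 ^ N : ℕ) : ℤ)),
            (∀ w : InfinitePlace K, 𝓕 (Sum.inl w) = ⊤) →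
            (∀ w : HeightOneSpectrum (𝓞 K), w ≠ v →
              𝓕 (Sum.inr w) = (galoisCohomology.map ((primaryInclusion (W.baseChange K) 2 N).restrictField (w.adicCompletion K)) 1).ker) →
            𝓕 (Sum.inr v) = ((galoisCohomology.map ((primaryInclusion (W.baseChange K) 2 N).restrictField (v.adicCompletion K)) 1).ker).comap
              (galoisCohomology.map (eN.restrictField (v.adicCompletion K)) 1) →
            (padicValNat 2 (𝓕.selmerGroup.relIndex (SelmerStructure.selmerGroup (Function.update 𝓕 (Sum.inr v : Place K) ⊤))) : ℤ) =
              ℓ + e₃ (d % 2) ((d / (2 - d % 2)) % 8)) :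
    ∃ e₃ : ℤ → ℤ → ℤ, ∀ (d : ℤ), d ≠ 0 → Squarefree d → d % 4 ≠ 1 →
      ∀ (W : WeierstrassCurve ℚ) [W.IsElliptic] [W.IsGloballyMinimal] (C : WeierstrassCurve.VariableChange ℚ),
        C • W = cm7.quadraticTwist (d : ℚ) → W.analyticRank = 1 →
      ∀ (K : Type) [Field K] [NumberField K], IsImaginaryQuadratic K →
      ∀ (v vbar : HeightOneSpectrum (𝓞 K)),
        ((2 : ℕ) : 𝓞 K) ∈ v.asIdeal → ((2 : ℕ) : 𝓞 K) ∈ vbar.asIdeal → vbar ≠ v →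
      ∀ (π : (W.baseChange K).endRing), (π : AddMonoid.End (W.baseChange K).geomPoints) * π = π - 2 →
      ∀ (r : ℤ_[2]), r * r = r - 2 →
        (∀ τ ∈ GreenbergSelmer.inertia v, ∀ x : ↥((W.baseChange K).endEigenPrimaryTorsion 2 π r), τ • x = x ∨ τ • x = -x) →
      ∀ (P : W.toAffine.Point) (c₀ : ℕ) (ℓ : ℤ),
        ¬ IsOfFinAddOrder P →
        (∀ R : W.toAffine.Point, ∃ (k : ℤ) (T : W.toAffine.Point), IsOfFinAddOrder T ∧ R = k • P + T) →
        c₀ ≠ 0 → (W.baseChange ℚ_[2]).IsInReductionKernel (c₀ • W.toPadicPoint 2 P) →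
        ‖(W.baseChange ℚ_[2]).padicLogPoint (c₀ • W.toPadicPoint 2 P) / (c₀ : ℚ_[2])‖ = (2 : ℝ) ^ (-ℓ) →
      Finite (restrictedSelmerBase ↥((W.baseChange K).endEigenPrimaryTorsion 2 π r) 2 vbar) →
        (padicValNat 2 (Nat.card ((resOfLe ↥((W.baseChange K).endEigenPrimaryTorsion 2 π r) (inf_le_left : ⊤ ⊓ decomp v ≤ ⊤)).comp
          (restrictedSelmerBase ↥((W.baseChange K).endEigenPrimaryTorsion 2 π r) 2 vbar).subtype).range) : ℤ) = ℓ + e₃ (d % 2) ((d / (2 - d % 2)) % 8) := by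
  obtain ⟨e₃, h⟩ := hcounts
  refine ⟨e₃, ?_⟩
  intro d hd0 hsq hd4 W _ _ C hC hrk K _ _ hK v vbar hv hvbar hne π hrel r hr hpin P c₀ ℓ hP hgen hc₀ hker hlog hfin
  haveI : Fact (Nat.Prime 2) := ⟨Nat.prime_two⟩
  haveI : IsTotallyComplex K := hK.2
  have hj : W.j = -3375 := j_eq_of_smul_eq_cm7Twist hd0 W C hC
  obtain ⟨θ, hθ⟩ := exists_sq_eq_neg_seven_of_cmEndo_mem_endRing W K hj π hrel
  obtain ⟨e, he₁, he0, -, he⟩ := exists_eigenProjector_two W hj K hθ π hrel hr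
  have hall : ∀ w : HeightOneSpectrum (𝓞 K), ((2 : ℕ) : 𝓞 K) ∈ w.asIdeal → w = v ∨ w = vbar :=
    fun w hw ↦ CMPrimes.eq_or_eq_of_two_mem K hK.1 hv hvbar hne hw
  obtain ⟨N₀, -, hN₀⟩ := exists_relIndex_selmerGroup_eq_natCard_range_resOfLe (W.baseChange K) 2 π r e he₁ he hv hne hall hfin
  obtain ⟨N₁, hN₁⟩ := h d hd0 hsq hd4 W C hC hrk K hK v vbar hv hvbar hne π hrel r hr hpin P c₀ ℓ hP hgen hc₀ hker hlog hfin e he₁ he0 he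
  obtain ⟨eN, heN, hcnt⟩ := hN₁ (max N₀ N₁) (le_max_right _ _)
  obtain ⟨𝓕, h𝓕inf, h𝓕, h𝓕v, hidx⟩ := hN₀ (max N₀ N₁) (le_max_left _ _) eN heN
  rw [← hidx]
  exact hcnt 𝓕 h𝓕inf h𝓕 h𝓕v

end Summit.BirchSwinnertonDyer.BirchSwinnertonDyer.Theorems.PrintCf2.RestrictedSelmerPair

end
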